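import Summits.HodgeConjecture.HodgeConjecture.Theorems.F0P6bWeilCartierDualityLetters   -- ★ PART A of the same Lines workfile (size-lint split; same namespace `Summit.HodgeConjecture.HodgeConjecture.Cruxes.HLiu418.F0P6bWeilCartierDuality`)
import HarnessLib

/-!
# ★ RE-HOME — PART B (size lint: `Theorems/` files with proofs are ≤ 400 lines) of the Lines workfile whose PART A is `Theorems/F0P6bWeilCartierDualityLetters.lean`.

Same namespace `Summit.HodgeConjecture.HodgeConjecture.Cruxes.HLiu418.F0P6bWeilCartierDuality` (every fully-qualified name unchanged); the preamble (options, `noncomputable section`, top-level `open`s) is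
repeated verbatim from Part A; the code below is the remainder of the tree bytes, untouched.  See Part A for the ★ re-home header and the original module
docstring.  HC_CM is proved only modulo the 7 printed citations (2 remaining: hLiu418 = stmt-HodgeConjecture-24832, h413 = stmt-HodgeConjecture-24833) until rung 0 closes.
-/


set_option autoImplicit false
set_option linter.dupNamespace false

-- Mathlib's `Over`/`Scheme` APIs are stated across semireducible wrappers (as in the ★ `GroupSchemes/*` files imported here).
set_option backward.isDefEq.respectTransparency false

noncomputable section

universe u

open CategoryTheory CategoryTheory.Limits AlgebraicGeometry MonoidalCategory CartesianMonoidalCategory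
open scoped MonObj
open Literature.AlgebraicGeometry.GroupSchemes Literature.AlgebraicGeometry.GroupSchemes.GroupSchemeKernel
open Literature.AlgebraicGeometry.GroupSchemes.AffineGroupScheme
open Literature.AlgebraicGeometry.Motives Literature.AlgebraicGeometry.Motives.AbelianVariety
open Literature.AlgebraicGeometry.AbelianSchemes Literature.AlgebraicGeometry.AbelianSchemes.AbelianSchemeOver
open Literature.AlgebraicGeometry.AbelianSchemes.AbelianSchemeOver.DualPair


namespace Summit.HodgeConjecture.HodgeConjecture.Cruxes.HLiu418.F0P6bWeilCartierDuality

/-! ## §3 Registered stubs (W1, W2, W3 — ALL PAID at ED. 2; ZERO sorries) -/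

/-- `stub_W1` — the letter (W1), PAID ((σ1-f) assembly): the family at `(A, D, G, j, hG, Ĝ, ĵ, hĜ)` is `Classical.choose` of ★
`WeilPairing.exists_weilIso'` at `D` when `D` is NORMALISED (the unit hypothesis holds) and at ★ `D.normalize` otherwise (same `Â`; ★
`nonempty_unitHatSlice_iso_normalize`) — an isomorphism `Ĝ ≅ G^D` of group schemes whose pairing values on finite points are the Weil characters
`e_q(x ≫ j, y ≫ ĵ)` (★ `weilChar`: (σ1-a) B-p04 Yoneda dock ★ `exists_hom_cartierDual_of_character_of_finite`, (σ1-b) ★ `weilUnit`, (σ1-c) ★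
`weilUnit_mul_right`, (σ1-d) ★ `eq_one_of_weilUnit_torsionTautSection'_eq_one` for the trivial kernel, ranks ★ `finrank_alg_eq_of_realises_torsion` + ★ (σ1-g) `DualPair.dim_hat_eq`);
`IsNatural`.1 = `IsMonHom` in both branches; `IsNatural`.2 (normalised `DA`, `DB`) = ★ `WeilPairing.weilHom_natural` ((σ1-e) ★ `weilUnit_comp_dualIsogenyOver`).
[cite: MumfordAV1970, §15 Thm. 1 (p. 143), §20 pp. 184–186] [cite: Tate1997FiniteFlatGroupSchemes, §(3.8) p. 145] -/
theorem stub_W1 : WeilPairingNatural.{u} := by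
  intro k _ _ p _ _ r
  classical
  refine ⟨fun A D G _ _ _ _ _ j _ _ hG Ĝ _ _ _ _ _ ĵ _ _ hĜ =>
    if hD : Nonempty ((Scheme.Modules.pullback D.unitHatSlice).obj D.P ≅ SheafOfModules.unit _) then
      Classical.choose (Literature.AlgebraicGeometry.AbelianSchemes.WeilPairing.exists_weilIso' p r A D hD (DualPair.dim_hat_eq A D) G j hG Ĝ ĵ hĜ)
    else
      Classical.choose (Literature.AlgebraicGeometry.AbelianSchemes.WeilPairing.exists_weilIso' p r A D.normalize
        D.nonempty_unitHatSlice_iso_normalize (DualPair.dim_hat_eq A D) G j hG Ĝ ĵ hĜ), ?_, ?_⟩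
  · intro A D G _ _ _ _ _ j _ _ hG Ĝ _ _ _ _ _ ĵ _ _ hĜ
    by_cases hD : Nonempty ((Scheme.Modules.pullback D.unitHatSlice).obj D.P ≅ SheafOfModules.unit _)
    · simp only [dif_pos hD]
      exact (Classical.choose_spec (Literature.AlgebraicGeometry.AbelianSchemes.WeilPairing.exists_weilIso' p r A D hD (DualPair.dim_hat_eq A D) G j hG
        Ĝ ĵ hĜ)).1
    · simp only [dif_neg hD]
      exact (Classical.choose_spec (Literature.AlgebraicGeometry.AbelianSchemes.WeilPairing.exists_weilIso' p r A D.normalize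
        D.nonempty_unitHatSlice_iso_normalize (DualPair.dim_hat_eq A D) G j hG Ĝ ĵ hĜ)).1
  · intro A B DA DB hDA hDB f GA _ _ _ _ _ jA _ _ hGA ĜA _ _ _ _ _ ĵA _ _ hĜA GB _ _ _ _ _ jB _ _ hGB ĜB _ _ _ _ _ ĵB _ _ hĜB
      β _ hβ βd hβd
    simp only [dif_pos hDA, dif_pos hDB]
    exact Literature.AlgebraicGeometry.AbelianSchemes.WeilPairing.weilHom_natural (p ^ r) A B DA DB hDA hDB f GA jA hGA ĜA ĵA hĜA GB jB hGB
      ĜB ĵB hĜB β hβ βd hβd _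
      (Classical.choose_spec (Literature.AlgebraicGeometry.AbelianSchemes.WeilPairing.exists_weilIso' p r A DA hDA (DualPair.dim_hat_eq A DA) GA jA hGA
        ĜA ĵA hĜA)).2 _
      (Classical.choose_spec (Literature.AlgebraicGeometry.AbelianSchemes.WeilPairing.exists_weilIso' p r B DB hDB (DualPair.dim_hat_eq B DB) GB jB hGB
        ĜB ĵB hĜB)).2

/-- `stub_W2` — the letter (W2), PAID: realise `A^{(q)}[q]`, `Â^{(q)}[q]` as chosen kernels (★ `ker`), take the family՚s duality `w′` there, lift the
Verschiebung `V` of `A` (★ `existsUnique_relFrobenius_comp_eq_pow_zsmul_id`) to `βV : A^{(q)}[q] → A[q]` and `F_Â` to `βF : Â[q] → Â^{(q)}[q]` (★ `kerLift`), read the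
`V`-square off `IsNatural`.2 at `f := V` through `(V)^∨ = F_Â` (★ `dualIsogenyOver_verschiebung_eq_relFrobenius`, p846646), and apply the dimension-free
Oda head ★ `exists_comp_annihilatorι_comp_inv_iff_exists_comp_of_frobenius'` (p846660). [cite: Oda1969, Cor. 1.3] [cite: MumfordAV1970, §15 Thm. 1 (p. 143)] -/
theorem stub_W2 : FrobeniusAnnihilator.{u} := by
  intro k _ _ p _ _ r w hw A D hD G _ _ _ _ _ j _ _ hG Ĝ _ _ _ _ _ ĵ _ _ hĜ Φ _ _ _ _ _ φ _ _ hΦ Φ' _ _ _ _ _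
    φ' _ _ hΦ' T x
  have hq0 : (((p ^ r : ℕ) : ℤ)) ≠ 0 := by exact_mod_cast pow_ne_zero r (Fact.out : p.Prime).ne_zero
  -- the twists `A^{(q)}`, `Â^{(q)}` and their `q`-torsion layers realised as chosen kernels
  let Aq : AbelianVariety k := A.frobeniusTwist p r
  let Ah : AbelianVariety k := D.hat.toAffine.toAbelianVariety
  let Ahq : AbelianVariety k := Ah.frobeniusTwist p r
  let qA : Aq.X ⟶ Aq.X := ((((p ^ r : ℕ) : ℤ) • 𝟙 Aq).hom.hom.hom)
  let qAh : Ahq.X ⟶ Ahq.X := ((((p ^ r : ℕ) : ℤ) • 𝟙 Ahq).hom.hom.hom)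
  haveI : IsFinite qA.left := (Aq.isIsogeny_zsmul_id_holds _ hq0).2
  haveI : IsCommMonObj (ker qA) := isCommMonObj_ker qA
  haveI : IsClosedImmersion (kerι qA).left := isClosedImmersion_kerι_left_of_isSeparated qA
  haveI : IsFinite (ker qA).hom := isFinite_ker_hom_of_isFinite_left qA
  haveI : IsAffine (ker qA).left := isAffine_of_isAffineHom (ker qA).hom
  haveI : Module.Finite k (Alg (ker qA)) := Alg.moduleFinite (ker qA)
  haveI : IsFinite qAh.left := (Ahq.isIsogeny_zsmul_id_holds _ hq0).2
  haveI : IsCommMonObj (ker qAh) := isCommMonObj_ker qAh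
  haveI : IsClosedImmersion (kerι qAh).left := isClosedImmersion_kerι_left_of_isSeparated qAh
  haveI : IsFinite (ker qAh).hom := isFinite_ker_hom_of_isFinite_left qAh
  haveI : IsAffine (ker qAh).left := isAffine_of_isAffineHom (ker qAh).hom
  haveI : Module.Finite k (Alg (ker qAh)) := Alg.moduleFinite (ker qAh)
  have hG' : ∀ ⦃T : SchemeOver k⦄ (t : T ⟶ Aq.X), (∃ s : T ⟶ ker qA, s ≫ kerι qA = t) ↔ t ≫ qA = 1 :=
    fun T t => GroupSchemeKernel.exists_comp_kerι_eq_iff qA t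
  have hĜ' : ∀ ⦃T : SchemeOver k⦄ (t : T ⟶ (D.frobeniusTwist p r A).hat.X),
      (∃ s : T ⟶ ker qAh, s ≫ kerι qAh = t) ↔
        t ≫ ((((p ^ r : ℕ) : ℤ) • 𝟙 (D.frobeniusTwist p r A).hat.toAffine.toAbelianVariety).hom.hom.hom) = 1 :=
    fun T t => GroupSchemeKernel.exists_comp_kerι_eq_iff qAh t
  -- the two dualities of the family
  haveI hw0 : IsMonHom (w A D G j hG Ĝ ĵ hĜ).hom := hw.1 A D G j hG Ĝ ĵ hĜ
  haveI hw' : IsMonHom (w Aq (D.frobeniusTwist p r A) (ker qA) (kerι qA) hG' (ker qAh) (kerι qAh) hĜ').hom :=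
    hw.1 Aq (D.frobeniusTwist p r A) (ker qA) (kerι qA) hG' (ker qAh) (kerι qAh) hĜ'
  -- the Verschiebung of `A` and its lift `βV : A^{(q)}[q] → A[q]`
  obtain ⟨V, hV, -⟩ := A.existsUnique_relFrobenius_comp_eq_pow_zsmul_id p r
  have hVq : (kerι qA ≫ V.hom.hom.hom) ≫ ((((p ^ r : ℕ) : ℤ) • 𝟙 A).hom.hom.hom) = 1 := by
    have e : V ≫ (((p ^ r : ℕ) : ℤ) • 𝟙 A) = (((p ^ r : ℕ) : ℤ) • 𝟙 Aq) ≫ V := by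
      rw [Preadditive.comp_zsmul, Preadditive.zsmul_comp, Category.comp_id, Category.id_comp]
    have e' := congrArg (fun f => f.hom.hom.hom) e
    change V.hom.hom.hom ≫ ((((p ^ r : ℕ) : ℤ) • 𝟙 A).hom.hom.hom) = qA ≫ V.hom.hom.hom at e'
    rw [Category.assoc, e', ← Category.assoc, kerι_comp, MonObj.one_comp]
  obtain ⟨βV, hβV⟩ := (hG (kerι qA ≫ V.hom.hom.hom)).2 hVq
  haveI : Mono j := (Over.forget _).mono_of_mono_map (inferInstanceAs (Mono j.left))
  haveI : IsMonHom (βV ≫ j) := by rw [hβV]; infer_instance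
  haveI : IsMonHom βV := isMonHom_of_comp j βV
  have hβVF : (βV ≫ j) ≫ (A.relFrobenius p r).hom.hom.hom = 1 := by
    have e := congrArg (fun f => f.hom.hom.hom) (A.comp_relFrobenius_eq_zsmul_id_of_relFrobenius_comp_eq p r V hV)
    change V.hom.hom.hom ≫ (A.relFrobenius p r).hom.hom.hom = qA at e
    rw [hβV, Category.assoc, e, kerι_comp]
  -- the lift `βF : Â[q] → Â^{(q)}[q]` of `F_Â`
  have hjq : ĵ ≫ ((((p ^ r : ℕ) : ℤ) • 𝟙 Ah).hom.hom.hom) = 1 := (hĜ ĵ).1 ⟨𝟙 _, Category.id_comp _⟩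
  have hFq : (ĵ ≫ (Ah.relFrobenius p r).hom.hom.hom) ≫ qAh = 1 := by
    have e : Ah.relFrobenius p r ≫ (((p ^ r : ℕ) : ℤ) • 𝟙 Ahq) = (((p ^ r : ℕ) : ℤ) • 𝟙 Ah) ≫ Ah.relFrobenius p r := by
      rw [Preadditive.comp_zsmul, Preadditive.zsmul_comp, Category.comp_id, Category.id_comp]
    have e' := congrArg (fun f => f.hom.hom.hom) e
    change (Ah.relFrobenius p r).hom.hom.hom ≫ qAh = ((((p ^ r : ℕ) : ℤ) • 𝟙 Ah).hom.hom.hom) ≫ (Ah.relFrobenius p r).hom.hom.hom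
      at e'
    rw [Category.assoc, e', reassoc_of% hjq, MonObj.one_comp]
  let βF : Ĝ ⟶ ker qAh := kerLift (ĵ ≫ (Ah.relFrobenius p r).hom.hom.hom) hFq
  have hβF : βF ≫ kerι qAh = ĵ ≫ (Ah.relFrobenius p r).hom.hom.hom := kerLift_ι _ hFq
  -- the `V`-square from naturality at `f := V` (unit hypotheses: `D^{(q)}` ★, `D`), read through `(V)^∨ = F_Â` ★
  have hβd : βF ≫ kerι qAh = ĵ ≫ dualIsogenyOver (A' := (AbelianScheme.ofAbelianVariety Aq).toOver)
      (B := (AbelianScheme.ofAbelianVariety A).toOver) V.hom.hom.hom (D.frobeniusTwist p r A) D := by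
    rw [dualIsogenyOver_verschiebung_eq_relFrobenius p r A D hD V hV]
    exact hβF
  have hsq := hw.2 Aq A (D.frobeniusTwist p r A) D (D.nonempty_unitHatSlice_frobeniusTwist_iso p r A hD) hD V
    (ker qA) (kerι qA) hG' (ker qAh) (kerι qAh) hĜ' G j hG Ĝ ĵ hĜ βV hβV βF hβd
  exact exists_comp_annihilatorι_comp_inv_iff_exists_comp_of_frobenius' p r A Ah G j Ĝ ĵ (w A D G j hG Ĝ ĵ hĜ)
    (ker qA) (ker qAh) (kerι qAh) (w Aq (D.frobeniusTwist p r A) (ker qA) (kerι qA) hG' (ker qAh) (kerι qAh) hĜ')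
    βV βF Φ φ Φ' φ' hG hĜ hβVF hβF hsq hΦ hΦ' x

/-- `stub_W3` — the letter (W3), PAID: realise `Â[q]` as the finite layer `Ker [q]_Â` (★ `GroupSchemeKernel.ker`; `[q]` an isogeny by ★
`isIsogeny_zsmul_id_holds`, any field) and apply ★ `exists_hermitian_lagrangian_duality_of_weil` (organ (T-W3), p846607) to the family՚s duality
`w_A`, its naturality in endomorphisms (`hw.2` at `A = B`, `DA = DB = D`) and its Frobenius-annihilator law (`hF` at `A`).
[cite: MumfordAV1970, §20 (I) (p. 189), §23] [cite: Oda1969, Cor. 1.3] -/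
theorem stub_W3 : PolarizationTransport.{u} := by
  intro k _ _ p _ _ r w hw hF A D hD pol G _ _ _ _ _ j _ _ hG hlam Φ _ _ _ _ _ φ _ _ hΦ O star act β _ hβ hRos
  -- realise `Â[q]` as the kernel of `[q]_Â` (★ `ker`), finite by ★ `isIsogeny_zsmul_id_holds` ([q] is an isogeny, any field)
  let Âv : AbelianVariety k := D.hat.toAffine.toAbelianVariety
  let qh : Âv.X ⟶ Âv.X := ((((p ^ r : ℕ) : ℤ) • 𝟙 Âv).hom.hom.hom)
  have hq0 : (((p ^ r : ℕ) : ℤ)) ≠ 0 := by exact_mod_cast pow_ne_zero r (expChar_pos k p).ne'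
  haveI : IsFinite qh.left := (Âv.isIsogeny_zsmul_id_holds _ hq0).2
  haveI : IsCommMonObj (ker qh) := isCommMonObj_ker qh
  haveI : IsClosedImmersion (kerι qh).left := isClosedImmersion_kerι_left_of_isSeparated qh
  haveI : IsFinite (ker qh).hom := isFinite_ker_hom_of_isFinite_left qh
  haveI : IsAffine (ker qh).left := isAffine_of_isAffineHom (ker qh).hom
  haveI : Module.Finite k (Alg (ker qh)) := Alg.moduleFinite (ker qh)
  have hĜ : ∀ ⦃T : SchemeOver k⦄ (t : T ⟶ D.hat.X), (∃ s : T ⟶ ker qh, s ≫ kerι qh = t) ↔ t ≫ qh = 1 :=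
    fun T t => GroupSchemeKernel.exists_comp_kerι_eq_iff qh t
  haveI : IsMonHom (w A D G j hG (ker qh) (kerι qh) hĜ).hom := hw.1 A D G j hG (ker qh) (kerι qh) hĜ
  exact exists_hermitian_lagrangian_duality_of_weil p r A D hD pol j hG hlam (kerι qh) hĜ (w A D G j hG (ker qh) (kerι qh) hĜ)
    (fun f β' _ hβ' βd hβd =>
      hw.2 A A D D hD hD f G j hG (ker qh) (kerι qh) hĜ G j hG (ker qh) (kerι qh) hĜ β' hβ' βd hβd)
    φ hΦ (fun Φ' _ _ _ _ _ φ' _ _ hΦ' => hF A D hD G j hG (ker qh) (kerι qh) hĜ Φ φ hΦ Φ' φ' hΦ') O star act β hβ hRos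

/-! ## §4 Head — kernel-checked composition `(W1) → (W2) → (W3) → WeilCartierDualityLagrangian` (no `sorry` outside the stubs) -/

/-- **`weilCartierDualityLagrangian_of_line : (W1) → (W2) → (W3) → WeilCartierDualityLagrangian`**: take the natural Weil family at level
`q = p^r` over `k` (W1), feed its naturality to (W2) to get the Frobenius annihilator law, and transport along `λ` (W3).
[cite: MumfordAV1970, §15 Thm. 1 (p. 143), §20 (I) (p. 189), §23] [cite: Oda1969, Cor. 1.3] -/
theorem weilCartierDualityLagrangian_of_line (h1 : WeilPairingNatural.{u}) (h2 : FrobeniusAnnihilator.{u})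
    (h3 : PolarizationTransport.{u}) : WeilCartierDualityLagrangian.{u} := by
  intro k _ _ p _ _ r A D hD pol G _ _ _ _ _ j _ _ hG hlam Φ _ _ _ _ _ φ _ _ hΦ O star act β _ hβ hRos
  obtain ⟨w, hw⟩ := h1 (k := k) p r
  exact h3 p r w hw (h2 p r w hw) A D hD pol G j hG hlam Φ φ hΦ O star act β hβ hRos

/-- The head restated on the registered stubs: at ED. 2 all three stubs are PAID, so the head type holds on this line OUTRIGHT (TRIO reading:
`--axioms` of this declaration = `[propext, Classical.choice, Quot.sound]`, no `sorryAx`). [cite: MumfordAV1970, §20 (I) (p. 189)] -/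
theorem weilCartierDualityLagrangian_holds : WeilCartierDualityLagrangian.{u} :=
  weilCartierDualityLagrangian_of_line stub_W1 stub_W2 stub_W3


/-! (★ re-home, size lint: this is PART A of `Lines/…` — the file continues, in the same namespace, in `Theorems/F0P6bWeilCartierDuality.lean`.) -/

end Summit.HodgeConjecture.HodgeConjecture.Cruxes.HLiu418.F0P6bWeilCartierDuality

end
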